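import Mathlib.RingTheory.Kaehler.Basic
import Mathlib.RingTheory.Derivation.Basic
import Mathlib.LinearAlgebra.ExteriorPower.Basic
import Mathlib.LinearAlgebra.Multilinear.Curry
import HarnessLib

/-!
# Alternating symbol maps on `Ωⁿ_K` from a tower of derivations

A general ENGINE for constructing maps out of the absolute differential forms `Ωⁿ_K = ⋀ⁿ_K Ω[K⁄ℤ]`
of a commutative ring `K` that are given on the generators by a product formula
`da₁ ∧ ⋯ ∧ daₙ ↦ δ(a₁) ∘ ⋯ ∘ δ(aₙ) (t₀)`:

**Data.** `K`-modules `T 0, T 1, T 2, …`, a base point `t₀ : T 0`, and for every `n` a DERIVATION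
`δ n : K → (T n →ₗ[K] T (n+1))` (additive, `δ(ab) = a • δ(b) + b • δ(a)`).
**Output.** `K`-multilinear maps `DerivationTower.sym δ t₀ n : Ω[K⁄ℤ]ⁿ → T n` with
`sym (da₀, ω) = δ n a₀ (sym ω)` (`sym_cons_D`), hence `sym (da₀, …, da_{n-1}) = δ a₀ (δ a₁ (⋯ t₀))`
(`sym_D`); they are built slot by slot from the universal property of Kähler differentials
(`Derivation.liftKaehlerDifferential`) and currying (`LinearMap.uncurryLeft`).
**Alternation.** If moreover `δ a ∘ δ a = 0` and `δ a ∘ δ b + δ b ∘ δ a = 0` (hypotheses `hN`, `hC`), each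
`sym n` is ALTERNATING (`sym_eq_zero_of_eq` — polarisation over the spanning set `{da}` of `Ω[K⁄ℤ]` and
induction on the slots), so it factors through the exterior power:
`DerivationTower.onForms : ⋀[K]^n (Ω[K⁄ℤ]) →ₗ[K] T n`, `onForms (da₁ ∧ ⋯ ∧ daₙ) = δ a₁ (⋯ (δ aₙ t₀))`
(`onForms_ιMulti_D`).

Instances in the tree: the Bloch–Kato symbol map (`BlochKatoForms.ofForms`, `δ(b) = b • e(b, –)`, written
out before this engine existed) and the inverse Cartier operator (`InverseCartierOperator`,
`δ(b) = b^{p-1} db ∧ –` on Frobenius-twisted de Rham cohomology).  `K`-linearity into a module whose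
`K`-structure is twisted by Frobenius encodes `p`-semilinearity, which is why the target modules are
arbitrary.  Everything is proved; no named fact. [folklore]
-/

noncomputable section

open KaehlerDifferential (D)

namespace Literature.NumberTheory.GaloisCohomology

universe u v

namespace DerivationTower

variable (K : Type u) [CommRing K]
variable (T : ℕ → Type v) [∀ n, AddCommGroup (T n)] [∀ n, Module K (T n)]

/-- Postcomposition with a fixed multilinear map `A : Ω[K⁄ℤ]ⁿ → T n`, as a `K`-linear map
`(T n →ₗ T (n+1)) → (Ω[K⁄ℤ]ⁿ → T (n+1))`. [folklore] -/
def postcomp {n : ℕ} (A : MultilinearMap K (fun _ : Fin n => Ω[K⁄ℤ]) (T n)) :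
    (T n →ₗ[K] T (n + 1)) →ₗ[K] MultilinearMap K (fun _ : Fin n => Ω[K⁄ℤ]) (T (n + 1)) where
  toFun L := L.compMultilinearMap A
  map_add' _ _ := rfl
  map_smul' _ _ := rfl

/-- `postcomp A L = L ∘ A` on tuples. [folklore] -/
@[simp] theorem postcomp_apply {n : ℕ} (A : MultilinearMap K (fun _ : Fin n => Ω[K⁄ℤ]) (T n))
    (L : T n →ₗ[K] T (n + 1)) (m : Fin n → Ω[K⁄ℤ]) : postcomp K T A L m = L (A m) := rfl

variable (δ : ∀ n, Derivation ℤ K (T n →ₗ[K] T (n + 1))) (t₀ : T 0)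

/-- **The symbol maps of a derivation tower**: `sym n : Ω[K⁄ℤ]ⁿ → T n`, `K`-multilinear, defined by
induction on `n` — `sym 0 = t₀`, and `sym (n+1) (ω₀, ω) = L(ω₀)(ω)` where `L` is the `K`-linear map induced
by the derivation `a ↦ δ n a ∘ sym n` (`LinearMap.compDer`, `Derivation.liftKaehlerDifferential`,
`LinearMap.uncurryLeft`). [folklore] -/
def sym : (n : ℕ) → MultilinearMap K (fun _ : Fin n => Ω[K⁄ℤ]) (T n)
  | 0 => MultilinearMap.constOfIsEmpty K _ t₀
  | n + 1 => LinearMap.uncurryLeft (R := K) (M := fun _ : Fin (n + 1) => Ω[K⁄ℤ]) (M₂ := T (n + 1))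
      (((postcomp K T (sym n)).compDer (δ n)).liftKaehlerDifferential)

/-- `sym 0 () = t₀`. [folklore] -/
theorem sym_zero_apply (m : Fin 0 → Ω[K⁄ℤ]) : sym K T δ t₀ 0 m = t₀ := rfl

/-- The inductive step unfolded. [folklore] -/
theorem sym_succ_apply (n : ℕ) (m : Fin (n + 1) → Ω[K⁄ℤ]) :
    sym K T δ t₀ (n + 1) m =
      ((postcomp K T (sym K T δ t₀ n)).compDer (δ n)).liftKaehlerDifferential (m 0) (Fin.tail m) := rfl

/-- `sym (da, ω) = δ a (sym ω)`. [folklore] -/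
theorem sym_cons_D (n : ℕ) (a : K) (m : Fin n → Ω[K⁄ℤ]) :
    sym K T δ t₀ (n + 1) (Fin.cons (D ℤ K a) m) = δ n a (sym K T δ t₀ n m) := by
  rw [sym_succ_apply, Fin.cons_zero, Fin.tail_cons, Derivation.liftKaehlerDifferential_comp_D]
  rfl

/-- The value of the tower on a tuple of scalars: `towerVal (a₀, …, a_{n-1}) = δ a₀ (δ a₁ (⋯ (δ a_{n-1} t₀)))`.
[folklore] -/
def towerVal : (n : ℕ) → (Fin n → K) → T n
  | 0, _ => t₀
  | n + 1, v => δ n (v 0) (towerVal n (Fin.tail v))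

/-- **`sym (da₀, …, da_{n-1}) = δ a₀ (⋯ (δ a_{n-1} t₀))`.** [folklore] -/
theorem sym_D : ∀ (n : ℕ) (v : Fin n → K), sym K T δ t₀ n (fun i => D ℤ K (v i)) = towerVal K T δ t₀ n v
  | 0, _ => rfl
  | n + 1, v => by
    conv_lhs => rw [← Fin.cons_self_tail (fun i => D ℤ K (v i))]
    rw [sym_cons_D]
    exact congrArg (δ n (v 0)) (sym_D n (Fin.tail v))

/-! ### Alternation -/

/-- If `sym ω = 0` then `sym (ω₀, ω) = 0` for every `ω₀` (linear in `ω₀`, zero on `{da}`). [folklore] -/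
theorem sym_cons_eq_zero_of_eq_zero (n : ℕ) (w : Fin n → Ω[K⁄ℤ]) (hw : sym K T δ t₀ n w = 0) (ω₀ : Ω[K⁄ℤ]) :
    sym K T δ t₀ (n + 1) (Fin.cons ω₀ w) = 0 := by
  rw [sym_succ_apply, Fin.cons_zero, Fin.tail_cons]
  have hmem : ω₀ ∈ Submodule.span K (Set.range (D ℤ K)) := by
    rw [KaehlerDifferential.span_range_derivation]; trivial
  induction hmem using Submodule.span_induction with
  | mem x hx =>
    obtain ⟨a, rfl⟩ := hx
    rw [Derivation.liftKaehlerDifferential_comp_D]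
    change δ n a (sym K T δ t₀ n w) = 0
    rw [hw, map_zero]
  | zero => rw [map_zero, zero_apply]
  | add x y _ _ hx hy => rw [map_add, add_apply, hx, hy, add_zero]
  | smul c x _ hx => rw [map_smul, smul_apply, hx, smul_zero]

/-- Vanishing of `sym (n+1)` when two TAIL slots agree, from the alternating property of `sym n`. [folklore] -/
theorem sym_succ_eq_zero_of_tail (n : ℕ)
    (IH : ∀ (w' : Fin n → Ω[K⁄ℤ]) (i j : Fin n), i ≠ j → w' i = w' j → sym K T δ t₀ n w' = 0)
    (w : Fin (n + 1) → Ω[K⁄ℤ]) (i j : Fin n) (hij : i ≠ j) (h : w i.succ = w j.succ) :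
    sym K T δ t₀ (n + 1) w = 0 := by
  rw [← Fin.cons_self_tail w]
  exact sym_cons_eq_zero_of_eq_zero K T δ t₀ n (Fin.tail w) (IH (Fin.tail w) i j hij h) (w 0)

/-- A multilinear map that vanishes whenever the slots `p ≠ q` agree is antisymmetric in `(p, q)`. [folklore] -/
theorem multilinear_swap_of_eq_zero {ι : Type*} [DecidableEq ι] {M N : Type*}
    [AddCommGroup M] [Module K M] [AddCommGroup N] [Module K N]
    (f : MultilinearMap K (fun _ : ι => M) N) {p q : ι} (hpq : p ≠ q)
    (hf : ∀ u : ι → M, u p = u q → f u = 0) (w : ι → M) :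
    f (w ∘ Equiv.swap p q) = -f w := by
  rw [Equiv.comp_swap_eq_update, eq_neg_iff_add_eq_zero]
  set s : M := w p + w q with hs
  have h0 : f (Function.update (Function.update w q s) p s) = 0 :=
    hf _ (by rw [Function.update_self, Function.update_of_ne hpq.symm, Function.update_self])
  have e2 : ∀ x : M, Function.update (Function.update w q s) p x =
      Function.update (Function.update w p x) q s := fun x => Function.update_comm hpq.symm s x w
  rw [hs, MultilinearMap.map_update_add, ← hs, e2, e2, MultilinearMap.map_update_add,
    MultilinearMap.map_update_add] at h0
  have h1 : f (Function.update (Function.update w p (w p)) q (w p)) = 0 :=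
    hf _ (by rw [Function.update_self, Function.update_of_ne hpq, Function.update_self])
  have h2 : f (Function.update (Function.update w p (w q)) q (w q)) = 0 :=
    hf _ (by rw [Function.update_self, Function.update_of_ne hpq, Function.update_self])
  have e3 : Function.update (Function.update w p (w q)) q (w p) =
      Function.update (Function.update w q (w p)) p (w q) := Function.update_comm hpq (w q) (w p) w
  rw [h1, zero_add, h2, add_zero, Function.update_eq_self, Function.update_eq_self, e3, add_comm] at h0
  exact h0

variable (hN : ∀ (n : ℕ) (a : K), (δ (n + 1) a).comp (δ n a) = 0)
variable (hC : ∀ (n : ℕ) (a b : K), (δ (n + 1) a).comp (δ n b) + (δ (n + 1) b).comp (δ n a) = 0)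
include hN hC

/-- Vanishing of `sym (n+2)` when the slots `0` and `1` agree: polarisation of `x ↦ sym (x, x, t)` over the
spanning set `{da}`, using `δ a ∘ δ a = 0` and `δ a ∘ δ b + δ b ∘ δ a = 0`. [folklore] -/
theorem sym_eq_zero_of_apply_zero_eq_apply_one (n : ℕ) (w : Fin (n + 2) → Ω[K⁄ℤ]) (h : w 0 = w 1) :
    sym K T δ t₀ (n + 2) w = 0 := by
  set t : Fin n → Ω[K⁄ℤ] := Fin.tail (Fin.tail w) with ht
  set f := sym K T δ t₀ (n + 2) with hf
  let β : Ω[K⁄ℤ] → Ω[K⁄ℤ] → T (n + 2) := fun x y => f (Fin.cons x (Fin.cons y t))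
  have hβ : ∀ x y, β x y = f (Fin.cons x (Fin.cons y t)) := fun x y => rfl
  have add₁ : ∀ x x' y, β (x + x') y = β x y + β x' y := fun x x' y => f.cons_add _ x x'
  have smul₁ : ∀ (c : K) x y, β (c • x) y = c • β x y := fun c x y => f.cons_smul _ c x
  have add₂ : ∀ x y y', β x (y + y') = β x y + β x y' := fun x y y' => by
    simp only [hβ, ← MultilinearMap.curryLeft_apply f x, MultilinearMap.cons_add]
  have smul₂ : ∀ (c : K) x y, β x (c • y) = c • β x y := fun c x y => by
    simp only [hβ, ← MultilinearMap.curryLeft_apply f x, MultilinearMap.cons_smul]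
  have zero₁ : ∀ y, β 0 y = 0 := fun y => by
    have := smul₁ 0 0 y; rwa [zero_smul, zero_smul] at this
  have zero₂ : ∀ x, β x 0 = 0 := fun x => by
    have := smul₂ 0 x 0; rwa [zero_smul, zero_smul] at this
  have hDD : ∀ a b : K, β (D ℤ K a) (D ℤ K b) = δ (n + 1) a (δ n b (sym K T δ t₀ n t)) := fun a b => by
    rw [hβ, sym_cons_D, sym_cons_D]
  have hspan : ∀ x : Ω[K⁄ℤ], x ∈ Submodule.span K (Set.range (D ℤ K)) := fun x => by
    rw [KaehlerDifferential.span_range_derivation]; trivial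
  have hB : ∀ x y, β x y + β y x = 0 := by
    have hBDD : ∀ a b : K, β (D ℤ K a) (D ℤ K b) + β (D ℤ K b) (D ℤ K a) = 0 := by
      intro a b
      rw [hDD, hDD]
      have hc := congrArg (fun L : T n →ₗ[K] T (n + 2) => L (sym K T δ t₀ n t)) (hC n a b)
      simpa only [LinearMap.add_apply, LinearMap.comp_apply, LinearMap.zero_apply] using hc
    have hBD : ∀ (a : K) (y : Ω[K⁄ℤ]), β (D ℤ K a) y + β y (D ℤ K a) = 0 := by
      intro a y
      induction hspan y using Submodule.span_induction with
      | mem y hy => obtain ⟨b, rfl⟩ := hy; exact hBDD a b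
      | zero => rw [zero₁, zero₂, add_zero]
      | add y y' _ _ hy hy' => rw [add₂, add₁, add_add_add_comm, hy, hy', add_zero]
      | smul c y _ hy => rw [smul₂, smul₁, ← smul_add, hy, smul_zero]
    intro x y
    induction hspan x using Submodule.span_induction with
    | mem x hx => obtain ⟨a, rfl⟩ := hx; exact hBD a y
    | zero => rw [zero₁, zero₂, add_zero]
    | add x x' _ _ hx hx' => rw [add₁, add₂, add_add_add_comm, hx, hx', add_zero]
    | smul c x _ hx => rw [smul₁, smul₂, ← smul_add, hx, smul_zero]
  have hQ : ∀ x, β x x = 0 := by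
    intro x
    induction hspan x using Submodule.span_induction with
    | mem x hx =>
      obtain ⟨a, rfl⟩ := hx
      rw [hDD]
      have hc := congrArg (fun L : T n →ₗ[K] T (n + 2) => L (sym K T δ t₀ n t)) (hN n a)
      simpa only [LinearMap.comp_apply, LinearMap.zero_apply] using hc
    | zero => exact zero₁ 0
    | add x x' _ _ hx hx' => rw [add₁, add₂, add₂, hx, hx', zero_add, add_zero, hB]
    | smul c x _ hx => rw [smul₁, smul₂, hx, smul_zero, smul_zero]
  have hw : w = Fin.cons (w 0) (Fin.cons (w 1) t) := by
    conv_lhs => rw [← Fin.cons_self_tail w, ← Fin.cons_self_tail (Fin.tail w)]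
    rfl
  rw [hw, ← hβ, h]
  exact hQ (w 1)

/-- **The symbol maps are alternating** (given `δ a ∘ δ a = 0` and `δ a ∘ δ b + δ b ∘ δ a = 0`): induction on
the slots — both in the tail (inductive hypothesis), `(0, 1)` (polarisation), `(0, j ≥ 2)` (antisymmetry in
the tail slots `1, j`). [folklore] -/
theorem sym_eq_zero_of_eq : ∀ (n : ℕ) (w : Fin n → Ω[K⁄ℤ]) (i j : Fin n), i ≠ j → w i = w j →
    sym K T δ t₀ n w = 0
  | 0, _, i, _, _, _ => i.elim0
  | 1, _, i, j, hij, _ => absurd (Subsingleton.elim i j) hij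
  | n + 2, w, i, j, hij, h => by
    have Htail : ∀ (u : Fin (n + 2) → Ω[K⁄ℤ]) (i j : Fin (n + 1)), i ≠ j → u i.succ = u j.succ →
        sym K T δ t₀ (n + 2) u = 0 :=
      fun u i j hij h => sym_succ_eq_zero_of_tail K T δ t₀ (n + 1)
        (sym_eq_zero_of_eq (n + 1)) u i j hij h
    have H0 : ∀ (u : Fin (n + 2) → Ω[K⁄ℤ]) (j' : Fin (n + 1)), u 0 = u j'.succ →
        sym K T δ t₀ (n + 2) u = 0 := by
      intro u j' hu
      rcases Fin.eq_zero_or_eq_succ j' with rfl | ⟨j'', rfl⟩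
      · exact sym_eq_zero_of_apply_zero_eq_apply_one K T δ t₀ hN hC n u hu
      · have hs := multilinear_swap_of_eq_zero K (sym K T δ t₀ (n + 2))
          (p := (0 : Fin (n + 1)).succ) (q := j''.succ.succ)
          (fun e => Fin.succ_ne_zero j'' (Fin.succ_injective _ e).symm)
          (fun u' hu' => Htail u' 0 j''.succ (Fin.succ_ne_zero j'').symm hu') u
        have h01 : (u ∘ Equiv.swap (0 : Fin (n + 1)).succ j''.succ.succ) 0 =
            (u ∘ Equiv.swap (0 : Fin (n + 1)).succ j''.succ.succ) 1 := by
          simp only [Function.comp_apply]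
          rw [Equiv.swap_apply_of_ne_of_ne (Fin.succ_ne_zero _).symm (Fin.succ_ne_zero _).symm,
            show (1 : Fin (n + 2)) = (0 : Fin (n + 1)).succ from rfl, Equiv.swap_apply_left]
          exact hu
        have h0 := sym_eq_zero_of_apply_zero_eq_apply_one K T δ t₀ hN hC n _ h01
        rwa [hs, neg_eq_zero] at h0
    rcases Fin.eq_zero_or_eq_succ i with rfl | ⟨i', rfl⟩ <;>
      rcases Fin.eq_zero_or_eq_succ j with rfl | ⟨j', rfl⟩
    · exact absurd rfl hij
    · exact H0 w j' h
    · exact H0 w i' h.symm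
    · exact Htail w i' j' (fun e => hij (congrArg Fin.succ e)) h

/-- The symbol map as an alternating map. [folklore] -/
def symAlt (n : ℕ) : Ω[K⁄ℤ] [⋀^Fin n]→ₗ[K] T n :=
  { sym K T δ t₀ n with
    map_eq_zero_of_eq' := fun w i j h hij => sym_eq_zero_of_eq K T δ t₀ hN hC n w i j hij h }

/-- `symAlt` is `sym` on tuples. [folklore] -/
@[simp] theorem symAlt_apply (n : ℕ) (w : Fin n → Ω[K⁄ℤ]) : symAlt K T δ t₀ hN hC n w = sym K T δ t₀ n w := rfl

/-- **The map on `n`-forms attached to a derivation tower**: `⋀ⁿ_K Ω[K⁄ℤ] → T n`,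
`da₁ ∧ ⋯ ∧ daₙ ↦ δ a₁ (⋯ (δ aₙ t₀))` (universal property of the exterior power). [folklore] -/
def onForms (n : ℕ) : ⋀[K]^n (Ω[K⁄ℤ]) →ₗ[K] T n :=
  exteriorPower.alternatingMapLinearEquiv (symAlt K T δ t₀ hN hC n)

/-- `onForms (ω₁ ∧ ⋯ ∧ ωₙ) = sym (ω₁, …, ωₙ)`. [folklore] -/
@[simp] theorem onForms_ιMulti (n : ℕ) (w : Fin n → Ω[K⁄ℤ]) :
    onForms K T δ t₀ hN hC n (exteriorPower.ιMulti K n w) = sym K T δ t₀ n w :=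
  exteriorPower.alternatingMapLinearEquiv_apply_ιMulti _ _

/-- `onForms (da₁ ∧ ⋯ ∧ daₙ) = δ a₁ (⋯ (δ aₙ t₀))`. [folklore] -/
theorem onForms_ιMulti_D (n : ℕ) (v : Fin n → K) :
    onForms K T δ t₀ hN hC n (exteriorPower.ιMulti K n fun i => D ℤ K (v i)) = towerVal K T δ t₀ n v := by
  rw [onForms_ιMulti, sym_D]

end DerivationTower

end Literature.NumberTheory.GaloisCohomology

end
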